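import Summits.QuantumFields.YangMills.Theorems.UnitScaleTiltProp7CombTildPureGauge
import Literature.MathematicalPhysics.QuantumFieldTheory.Balaban1983to89.B7Prop3GeneralTild
import HarnessLib

/-!
# Route `UnitScaleTilt`, crux K1 «MinimiserStabilityRegPr» (stmt-QuantumFields-19200), route-R E′ (A′)-on-Σ, P-A2 (β), row «(n3)-comb» —
# (O2) GROUNDWORK, file F-4: THE STRUCTURE RECURSION OF THE LINEARISED CORNERED COMB TOWER AT A CURVED BACKGROUND —
# `Q_k Y = G_k + ∇^{Ū₀ᵏ}Λ_k` EXACTLY, with `G_{k+1} = T_kG_k − ∇^{Ū₀ᵏ⁺¹}(CM_kG_k)`, `Λ_{k+1} = CM_kG_k + Λ_k ∘ (L•·)`, for ANY coarse-site maps `CM_k`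

«(O2) groundwork — not consumed by any displayed row before the freeze lifts» (★★OWNER `ym3-torus-plan` g29 RULINGS №20 (2), №22; «(II) GO» 06:26∕06:31Z).
Cell `ym3-torus`, D-0154 (3c) R3 twin-width seat `ym-routeR-w1` (gen 9); DESIGN memo `DESIGN-N3COMB-LINEAR-CORE-routeRw1g9.md` §1 row 3, file list §5 F-4.
THEOREMS ONLY (0 `def`, 0 `sorry`); `--supports stmt-QuantumFields-19200 --as helper`, count-neutral.  YM₃ on T³ is a ladder rung (R3), not the Clay problem; nothing here claims
`hMcomb`, `hMcomb₂`, (β), `hPA2`, `hcoS`, the stub, the crux, d = 4 or the mass gap.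

THE POINT.  ✓`Prop7TrueLinIterStructure.trueLinIter_structure` (ym-ust-20520-w2 g3) proves, for the route's symmetric (0.4) tower, the exact decomposition of the k-fold linearised
descent into a «reduced» part `G_k` and a covariant coarse gradient of an accumulated gauge function `Λ_k`, for ARBITRARY coarse-site maps `CM_j`, from two properties of the
one-step operator: linearity and exactness on covariant gradients.  For PRINT's cornered comb tower ([Balaban1985Averaging] (42)∕(43), (65)∕(68)) the one-step operator is the
true derivative `T_k` of ✓`Prop7CombTildTrueLin` (p702302) at the background `Ū₀ᵏ = avgIter L U₀ k` (corner `q = L•z`), its linearity is lit `tsum_add` + linearity of `fderiv`,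
and its exactness is ✓`Prop7CombTildPureGauge.trueLin_covGrad_eq_level` (F-3).  This file is the re-instantiation: `Q`, `G`, `Λ`, `CM` are abstract families tied by displayed
recursion texts (zero content, the pattern of ✓`Prop7CurvedLandauRowA`); the «restriction to the corners» of the design memos (★routeR-w6 PREREAD §0: `Ψ_{j+1} = Ψ_j|_{corners} − …`)
is the precomposition with `z ↦ L•z` (lit `rescale`).  With `CM_k :=` the cornered covariant comb mean this is §0 of the (II) design at a curved background; with `CM := 0` it says
`Q = G` (no split).

WHAT IS PROVED (ns `…Theorems.Prop7CornerCombStructure`; `𝔸` any C⋆-algebra; every `d`, `L`, every `U₀`).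
* §1 `trueStep_add` — the cornered one-step operator (written out) is additive in the field.
* §2 ★★ `cornerComb_structure` — `∀ k ≤ n, ∀ z κ, Q k Y z κ = G k z κ + (Λ k z − Ad_{Ū₀ᵏ(z,κ)} Λ k (z + e κ))` under the recursion texts and the unit loop window below level `n`.
* §4 `exists_linTower_family`, `exists_reduced_gauge_family` — the recursion families exist (definitions by recursion on the level, zero content).
* §3 `norm_reduced_le_of_structure` — `‖G k z κ‖ ≤ ‖Q k Y z κ‖ + ‖Λ k z‖ + ‖Λ k (z + e κ)‖` at a `U1`-valued coarse bond (the structure identity read with the triangle inequality).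
HONEST SCOPE.  Identities and one triangle inequality; `CM` arbitrary; no estimate of `G` or `Λ` (files F-5, F-6).  Nothing of Bałaban's is asserted beyond the cited tree∕lit theorems.

References: T. Bałaban, CMP **98** (1985) 17–51 [Balaban1985Averaging] ((11) p.19, (42)–(43) pp.23–24, (65)∕(68) p.29, (119)–(120) p.35); CMP **95** (1984) 17–40
[Balaban1984PropagatorsI] ((1.18)–(1.20) pp.19–20); CMP **109** (1987) 249–301 [Balaban1987RG1] ((0.4), (0.6) p.253).
-/

noncomputable section

open scoped BigOperators

namespace Summit.QuantumFields.YangMills.Theorems.Prop7CornerCombStructure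

open NormedSpace
open Literature.MathematicalPhysics.QuantumFieldTheory.Balaban1983to89
open ExpMeanLog (eml)
open B7Prop1Explicit (Site Letter e hol seg boxVec gammaWord Wcx Xavg bavg expUnit)
open B7Prop2Explicit (avgIter unitaryUnits unitaryUnits_le_U1)
open B7Eq78Linearization (conjR conjR_apply conjR_add conjR_sub)
open B7Prop3GeneralRotated (tsum norm_conjR_le)
open B7Prop3GeneralTild (tsum_add)
open Summit.QuantumFields.YangMills.Theorems.Prop7CombTildPureGauge (trueLin_covGrad_eq_level)

variable {d : ℕ} {𝔸 : Type*} [CStarAlgebra 𝔸]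

/-! ## §1 The one-step operator is additive -/

/-- **Additivity of the cornered one-step true derivative** (written out): lit ✓`tsum_add` on every walk and the linearity of `D eml(W₀)`. [cite: Balaban1985Averaging, (119)-(122) pp.35-36] -/
theorem trueStep_add (L : ℕ) (V₀ : Site d → Fin d → 𝔸ˣ) (X X' : Site d → Fin d → 𝔸) (q : Site d) (κ : Fin d) :
    fderiv ℂ (eml : ((Fin d → Fin L) → 𝔸) → 𝔸) (fun r => ((Wcx L V₀ q κ (boxVec L r) : 𝔸ˣ) : 𝔸))
          (fun r => tsum V₀ (X + X') q (gammaWord L κ (boxVec L r) ++ seg κ (-(L : ℤ))) * ((Wcx L V₀ q κ (boxVec L r) : 𝔸ˣ) : 𝔸))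
          * (((expUnit (Xavg L V₀ q κ))⁻¹ : 𝔸ˣ) : 𝔸)
        + ((expUnit (Xavg L V₀ q κ) : 𝔸ˣ) : 𝔸) * tsum V₀ (X + X') q (seg κ (L : ℤ)) * (((expUnit (Xavg L V₀ q κ))⁻¹ : 𝔸ˣ) : 𝔸)
      = (fderiv ℂ (eml : ((Fin d → Fin L) → 𝔸) → 𝔸) (fun r => ((Wcx L V₀ q κ (boxVec L r) : 𝔸ˣ) : 𝔸))
            (fun r => tsum V₀ X q (gammaWord L κ (boxVec L r) ++ seg κ (-(L : ℤ))) * ((Wcx L V₀ q κ (boxVec L r) : 𝔸ˣ) : 𝔸))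
            * (((expUnit (Xavg L V₀ q κ))⁻¹ : 𝔸ˣ) : 𝔸)
          + ((expUnit (Xavg L V₀ q κ) : 𝔸ˣ) : 𝔸) * tsum V₀ X q (seg κ (L : ℤ)) * (((expUnit (Xavg L V₀ q κ))⁻¹ : 𝔸ˣ) : 𝔸))
        + (fderiv ℂ (eml : ((Fin d → Fin L) → 𝔸) → 𝔸) (fun r => ((Wcx L V₀ q κ (boxVec L r) : 𝔸ˣ) : 𝔸))
            (fun r => tsum V₀ X' q (gammaWord L κ (boxVec L r) ++ seg κ (-(L : ℤ))) * ((Wcx L V₀ q κ (boxVec L r) : 𝔸ˣ) : 𝔸))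
            * (((expUnit (Xavg L V₀ q κ))⁻¹ : 𝔸ˣ) : 𝔸)
          + ((expUnit (Xavg L V₀ q κ) : 𝔸ˣ) : 𝔸) * tsum V₀ X' q (seg κ (L : ℤ)) * (((expUnit (Xavg L V₀ q κ))⁻¹ : 𝔸ˣ) : 𝔸)) := by
  have hdir : (fun r : Fin d → Fin L => tsum V₀ (X + X') q (gammaWord L κ (boxVec L r) ++ seg κ (-(L : ℤ))) * ((Wcx L V₀ q κ (boxVec L r) : 𝔸ˣ) : 𝔸))
      = (fun r => tsum V₀ X q (gammaWord L κ (boxVec L r) ++ seg κ (-(L : ℤ))) * ((Wcx L V₀ q κ (boxVec L r) : 𝔸ˣ) : 𝔸))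
        + (fun r => tsum V₀ X' q (gammaWord L κ (boxVec L r) ++ seg κ (-(L : ℤ))) * ((Wcx L V₀ q κ (boxVec L r) : 𝔸ˣ) : 𝔸)) := by
    funext r; simp only [Pi.add_apply]; rw [tsum_add, add_mul]
  rw [hdir, map_add, tsum_add]
  noncomm_ring

/-! ## §2 ★★ The structure recursion -/

/-- ★★ **STRUCTURE OF THE LINEARISED CORNERED COMB TOWER AT A CURVED BACKGROUND**: let `Ū₀ᵏ = avgIter L U₀ k` (every level read on `ℤᵈ`, lit `rescale`), let `Q k Y` be the k-fold
linearised tower of `Y` (`Q 0 Y = Y`, `Q (k+1) Y (z,κ) = T_k(Q k Y)(L•z, κ)` with `T_k` the one-step true derivative of ✓`Prop7CombTildTrueLin` at `Ū₀ᵏ`, written out), and for ARBITRARY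
coarse-site maps `CM k : (level-k fields) → (level-(k+1) site fields)` let `G`, `Λ` be the families `G 0 = Y`, `G (k+1) (z,κ) = T_k(G k)(L•z,κ) − [CM k (G k) z − Ad_{Ū₀ᵏ⁺¹(z,κ)} CM k (G k) (z + e κ)]`,
`Λ 0 = 0`, `Λ (k+1) z = CM k (G k) z + Λ k (L•z)`.  If every block loop of `Ū₀ᵏ` below level `n` is in the unit window of the series logarithm, then for every `k ≤ n`:
`Q k Y (z,κ) = G k (z,κ) + (Λ k z − Ad_{Ū₀ᵏ(z,κ)} Λ k (z + e κ))` — by induction: additivity (§1) and exactness on covariant gradients (✓`trueLin_covGrad_eq_level`, F-3).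
The cornered∕`ℤᵈ` twin of ✓`Prop7TrueLinIterStructure.trueLinIter_structure`. «(O2) groundwork.» [cite: Balaban1985Averaging, (11) p.19, (43) p.24, (68) p.29, (119)-(120) p.35; Balaban1984PropagatorsI, (1.18)-(1.20) pp.19-20] -/
theorem cornerComb_structure (L : ℕ) (U₀ : Site d → Fin d → 𝔸ˣ) (Y : Site d → Fin d → 𝔸) (n : ℕ)
    (hW : ∀ k < n, ∀ (z : Site d) (κ : Fin d) (r : Fin d → Fin L), ‖((Wcx L (avgIter L U₀ k) ((L : ℤ) • z) κ (boxVec L r) : 𝔸ˣ) : 𝔸) - 1‖ < 1)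
    (Q : ℕ → (Site d → Fin d → 𝔸) → Site d → Fin d → 𝔸) (hQ0 : Q 0 Y = Y)
    (hQs : ∀ (k : ℕ) (z : Site d) (κ : Fin d), Q (k + 1) Y z κ
      = fderiv ℂ (eml : ((Fin d → Fin L) → 𝔸) → 𝔸) (fun r => ((Wcx L (avgIter L U₀ k) ((L : ℤ) • z) κ (boxVec L r) : 𝔸ˣ) : 𝔸))
            (fun r => tsum (avgIter L U₀ k) (Q k Y) ((L : ℤ) • z) (gammaWord L κ (boxVec L r) ++ seg κ (-(L : ℤ)))
              * ((Wcx L (avgIter L U₀ k) ((L : ℤ) • z) κ (boxVec L r) : 𝔸ˣ) : 𝔸))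
            * (((expUnit (Xavg L (avgIter L U₀ k) ((L : ℤ) • z) κ))⁻¹ : 𝔸ˣ) : 𝔸)
          + ((expUnit (Xavg L (avgIter L U₀ k) ((L : ℤ) • z) κ) : 𝔸ˣ) : 𝔸) * tsum (avgIter L U₀ k) (Q k Y) ((L : ℤ) • z) (seg κ (L : ℤ))
            * (((expUnit (Xavg L (avgIter L U₀ k) ((L : ℤ) • z) κ))⁻¹ : 𝔸ˣ) : 𝔸))
    (CM : ℕ → (Site d → Fin d → 𝔸) → Site d → 𝔸)
    (G : ℕ → Site d → Fin d → 𝔸) (Λ : ℕ → Site d → 𝔸) (hG0 : G 0 = Y) (hΛ0 : ∀ z, Λ 0 z = 0)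
    (hGs : ∀ (k : ℕ) (z : Site d) (κ : Fin d), G (k + 1) z κ
      = (fderiv ℂ (eml : ((Fin d → Fin L) → 𝔸) → 𝔸) (fun r => ((Wcx L (avgIter L U₀ k) ((L : ℤ) • z) κ (boxVec L r) : 𝔸ˣ) : 𝔸))
            (fun r => tsum (avgIter L U₀ k) (G k) ((L : ℤ) • z) (gammaWord L κ (boxVec L r) ++ seg κ (-(L : ℤ)))
              * ((Wcx L (avgIter L U₀ k) ((L : ℤ) • z) κ (boxVec L r) : 𝔸ˣ) : 𝔸))
            * (((expUnit (Xavg L (avgIter L U₀ k) ((L : ℤ) • z) κ))⁻¹ : 𝔸ˣ) : 𝔸)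
          + ((expUnit (Xavg L (avgIter L U₀ k) ((L : ℤ) • z) κ) : 𝔸ˣ) : 𝔸) * tsum (avgIter L U₀ k) (G k) ((L : ℤ) • z) (seg κ (L : ℤ))
            * (((expUnit (Xavg L (avgIter L U₀ k) ((L : ℤ) • z) κ))⁻¹ : 𝔸ˣ) : 𝔸))
        - (CM k (G k) z - conjR (avgIter L U₀ (k + 1) z κ) (CM k (G k) (z + e κ))))
    (hΛs : ∀ (k : ℕ) (z : Site d), Λ (k + 1) z = CM k (G k) z + Λ k ((L : ℤ) • z)) :
    ∀ k ≤ n, ∀ (z : Site d) (κ : Fin d), Q k Y z κ = G k z κ + (Λ k z - conjR (avgIter L U₀ k z κ) (Λ k (z + e κ))) := by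
  intro k
  induction k with
  | zero =>
    intro _ z κ
    rw [hQ0, hG0, hΛ0, hΛ0]
    simp [conjR_apply]
  | succ k ih =>
    intro hk z κ
    have hk' : k < n := Nat.lt_of_succ_le hk
    have ihk := ih hk'.le
    -- the level-k field `Q k Y` is `G k + ∇Λ k` as a function
    have hfun : Q k Y = G k + fun x μ => Λ k x - conjR (avgIter L U₀ k x μ) (Λ k (x + e μ)) := by
      funext x μ; rw [Pi.add_apply, Pi.add_apply]; exact ihk x μ
    -- exactness of the one-step operator on the covariant gradient of `Λ k` (F-3)
    have hex := trueLin_covGrad_eq_level L U₀ k (Λ k) (fun x μ => Λ k x - conjR (avgIter L U₀ k x μ) (Λ k (x + e μ)))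
      (fun _ _ => rfl) z κ (hW k hk' z κ)
    rw [hQs, hfun, trueStep_add, hex, hGs, hΛs, hΛs, conjR_add, smul_add]
    abel

/-! ## §3 The reduced part against the full field and the gauge function -/

omit [CStarAlgebra 𝔸] in
/-- **`‖G_k(c)‖ ≤ ‖Q_kY(c)‖ + ‖Λ_k(c₋)‖ + ‖Λ_k(c₊)‖`** at a `U1`-valued coarse bond (from the structure identity; conjugation by a `U1` unit is non-expansive). [cite: Balaban1985Averaging, (56)-(57) p.27] -/
theorem norm_reduced_le_of_structure {𝔸 : Type*} [NormedRing 𝔸] [NormOneClass 𝔸] [NormedAlgebra ℂ 𝔸] [CompleteSpace 𝔸]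
    {u : 𝔸ˣ} (hu : u ∈ B7Prop1Explicit.U1 𝔸) {q g l l' : 𝔸} (h : q = g + (l - conjR u l')) :
    ‖g‖ ≤ ‖q‖ + ‖l‖ + ‖l'‖ := by
  have e : g = q - (l - conjR u l') := by rw [h]; abel
  rw [e]
  calc ‖q - (l - conjR u l')‖ ≤ ‖q‖ + ‖l - conjR u l'‖ := norm_sub_le _ _
    _ ≤ ‖q‖ + (‖l‖ + ‖conjR u l'‖) := by gcongr; exact norm_sub_le _ _
    _ ≤ ‖q‖ + (‖l‖ + ‖l'‖) := by gcongr; exact norm_conjR_le hu l'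
    _ = ‖q‖ + ‖l‖ + ‖l'‖ := by ring

/-! ## §4 The recursion families exist (zero content: definitions by recursion on the level) -/

/-- **The linearised tower family exists** (recursion `Q 0 Y = Y`, `Q (k+1) Y (z,κ) = T_k(Q k Y)(L•z, κ)`; the text of `cornerComb_structure`'s `hQ0`∕`hQs`). [cite: Balaban1985Averaging, (43) p.24, (68) p.29] -/
theorem exists_linTower_family (L : ℕ) (U₀ : Site d → Fin d → 𝔸ˣ) :
    ∃ Q : ℕ → (Site d → Fin d → 𝔸) → Site d → Fin d → 𝔸, (∀ Y, Q 0 Y = Y) ∧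
      ∀ (k : ℕ) (Y : Site d → Fin d → 𝔸) (z : Site d) (κ : Fin d), Q (k + 1) Y z κ
        = fderiv ℂ (eml : ((Fin d → Fin L) → 𝔸) → 𝔸) (fun r => ((Wcx L (avgIter L U₀ k) ((L : ℤ) • z) κ (boxVec L r) : 𝔸ˣ) : 𝔸))
              (fun r => tsum (avgIter L U₀ k) (Q k Y) ((L : ℤ) • z) (gammaWord L κ (boxVec L r) ++ seg κ (-(L : ℤ)))
                * ((Wcx L (avgIter L U₀ k) ((L : ℤ) • z) κ (boxVec L r) : 𝔸ˣ) : 𝔸))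
              * (((expUnit (Xavg L (avgIter L U₀ k) ((L : ℤ) • z) κ))⁻¹ : 𝔸ˣ) : 𝔸)
            + ((expUnit (Xavg L (avgIter L U₀ k) ((L : ℤ) • z) κ) : 𝔸ˣ) : 𝔸) * tsum (avgIter L U₀ k) (Q k Y) ((L : ℤ) • z) (seg κ (L : ℤ))
              * (((expUnit (Xavg L (avgIter L U₀ k) ((L : ℤ) • z) κ))⁻¹ : 𝔸ˣ) : 𝔸) := by
  refine ⟨fun k => Nat.rec (motive := fun _ => (Site d → Fin d → 𝔸) → Site d → Fin d → 𝔸) (fun Y => Y)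
    (fun k Qk => fun Y z κ =>
      fderiv ℂ (eml : ((Fin d → Fin L) → 𝔸) → 𝔸) (fun r => ((Wcx L (avgIter L U₀ k) ((L : ℤ) • z) κ (boxVec L r) : 𝔸ˣ) : 𝔸))
          (fun r => tsum (avgIter L U₀ k) (Qk Y) ((L : ℤ) • z) (gammaWord L κ (boxVec L r) ++ seg κ (-(L : ℤ)))
            * ((Wcx L (avgIter L U₀ k) ((L : ℤ) • z) κ (boxVec L r) : 𝔸ˣ) : 𝔸))
          * (((expUnit (Xavg L (avgIter L U₀ k) ((L : ℤ) • z) κ))⁻¹ : 𝔸ˣ) : 𝔸)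
        + ((expUnit (Xavg L (avgIter L U₀ k) ((L : ℤ) • z) κ) : 𝔸ˣ) : 𝔸) * tsum (avgIter L U₀ k) (Qk Y) ((L : ℤ) • z) (seg κ (L : ℤ))
          * (((expUnit (Xavg L (avgIter L U₀ k) ((L : ℤ) • z) κ))⁻¹ : 𝔸ˣ) : 𝔸)) k, fun Y => rfl, fun k Y z κ => rfl⟩

/-- **The reduced and gauge families exist** for any coarse-site maps `CM` (the texts of `cornerComb_structure`'s `hG0`∕`hGs`∕`hΛ0`∕`hΛs`). [cite: Balaban1984PropagatorsI, (1.18)-(1.20) pp.19-20] -/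
theorem exists_reduced_gauge_family (L : ℕ) (U₀ : Site d → Fin d → 𝔸ˣ) (Y : Site d → Fin d → 𝔸) (CM : ℕ → (Site d → Fin d → 𝔸) → Site d → 𝔸) :
    ∃ (G : ℕ → Site d → Fin d → 𝔸) (Λ : ℕ → Site d → 𝔸), G 0 = Y ∧ (∀ z, Λ 0 z = 0) ∧
      (∀ (k : ℕ) (z : Site d) (κ : Fin d), G (k + 1) z κ
        = (fderiv ℂ (eml : ((Fin d → Fin L) → 𝔸) → 𝔸) (fun r => ((Wcx L (avgIter L U₀ k) ((L : ℤ) • z) κ (boxVec L r) : 𝔸ˣ) : 𝔸))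
              (fun r => tsum (avgIter L U₀ k) (G k) ((L : ℤ) • z) (gammaWord L κ (boxVec L r) ++ seg κ (-(L : ℤ)))
                * ((Wcx L (avgIter L U₀ k) ((L : ℤ) • z) κ (boxVec L r) : 𝔸ˣ) : 𝔸))
              * (((expUnit (Xavg L (avgIter L U₀ k) ((L : ℤ) • z) κ))⁻¹ : 𝔸ˣ) : 𝔸)
            + ((expUnit (Xavg L (avgIter L U₀ k) ((L : ℤ) • z) κ) : 𝔸ˣ) : 𝔸) * tsum (avgIter L U₀ k) (G k) ((L : ℤ) • z) (seg κ (L : ℤ))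
              * (((expUnit (Xavg L (avgIter L U₀ k) ((L : ℤ) • z) κ))⁻¹ : 𝔸ˣ) : 𝔸))
          - (CM k (G k) z - conjR (avgIter L U₀ (k + 1) z κ) (CM k (G k) (z + e κ)))) ∧
      ∀ (k : ℕ) (z : Site d), Λ (k + 1) z = CM k (G k) z + Λ k ((L : ℤ) • z) := by
  let G : ℕ → Site d → Fin d → 𝔸 := fun k => Nat.rec (motive := fun _ => Site d → Fin d → 𝔸) Y
    (fun k Gk => fun z κ =>
      (fderiv ℂ (eml : ((Fin d → Fin L) → 𝔸) → 𝔸) (fun r => ((Wcx L (avgIter L U₀ k) ((L : ℤ) • z) κ (boxVec L r) : 𝔸ˣ) : 𝔸))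
            (fun r => tsum (avgIter L U₀ k) Gk ((L : ℤ) • z) (gammaWord L κ (boxVec L r) ++ seg κ (-(L : ℤ)))
              * ((Wcx L (avgIter L U₀ k) ((L : ℤ) • z) κ (boxVec L r) : 𝔸ˣ) : 𝔸))
            * (((expUnit (Xavg L (avgIter L U₀ k) ((L : ℤ) • z) κ))⁻¹ : 𝔸ˣ) : 𝔸)
          + ((expUnit (Xavg L (avgIter L U₀ k) ((L : ℤ) • z) κ) : 𝔸ˣ) : 𝔸) * tsum (avgIter L U₀ k) Gk ((L : ℤ) • z) (seg κ (L : ℤ))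
            * (((expUnit (Xavg L (avgIter L U₀ k) ((L : ℤ) • z) κ))⁻¹ : 𝔸ˣ) : 𝔸))
        - (CM k Gk z - conjR (avgIter L U₀ (k + 1) z κ) (CM k Gk (z + e κ)))) k
  refine ⟨G, fun k => Nat.rec (motive := fun _ => Site d → 𝔸) (fun _ => 0) (fun k Λk => fun z => CM k (G k) z + Λk ((L : ℤ) • z)) k,
    rfl, fun _ => rfl, fun k z κ => rfl, fun k z => rfl⟩

end Summit.QuantumFields.YangMills.Theorems.Prop7CornerCombStructure

end
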